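import Summits.QuantumFields.YangMills.Theorems.BalabanUVNodesN05SubBP2DK2PerKappaSlotExistsOfGuardedSockets

/-!
# BalabanUVNodes ∕ N05 ([Balaban1985RegularSpaces] Lemma 1 p. 79 – Thm 8 p. 101, Prop. 5 p. 94, (1.3)–(1.5) p. 77, p. 77 «Ω_j ⊂ T_η»): (10)′ PART B — THE Slot8κ′ λ-TERM's
# ∃-BODY FROM THE PERIODICITY-GUARDED SOCKETS, LITERALLY (the period pinned to `P := Mκ·θ.L`; part A `…OfGuardedSockets` is the period-generic theorem)

Track A of `YM-PLAN.md` (cell `pub-ymgap`, HUMAN RULING D-0062), node **N05**; seat `pub-ymgap-dag-n05-d` (g14), 2026-08-28; bears on K1⁹ `stmt-QuantumFields-27364`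
(`--supports … --as helper`, count-neutral).  Director-ym №227 (b) ∕ (b′-2), №230 (B); plan YMPLAN-G87-N05-10PRIME; dag-n24-c (R3′).
WHAT IS PROVED (one theorem; no estimate; no new definition): ★★★ `exists_residB8_slot8κ'_of_guardedSockets` — part A's hypotheses VERBATIM at `P := Mκ·θ.L`, `(hM₁ : 1 ≤ Mκ)` ⊢
`∃ lam8, ∃ P c₁ ρ₀ ax, (0 < P ∧ Mκ * θ.L ∣ P) ∧ 0 < c₁ ∧ 1 ≤ ρ₀ ∧ B8LeafOfRecordSubBP₂DPerκ θ P Mκ Rκ ⟨lam8.cutSubBP₅κPer P Mκ Rκ c₁ ρ₀, ax⟩` (the κ-index inhabitation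
guard `θ.L ≤ Rκ·Mκ` is the door's — part A's `nonempty_idxB8SubDPerκ_slot8κ'`).
DOOR RECIPE (plan YMPLAN-G87-N05-10PRIME-2; for the K1⁹ door lineage): `hP6 ∕ hB₁big` are served BY NAME by dag-n05-e's PROVED `B8Prop6PrintedZdCubPGamma.prop6Printed_zdCubP_γ_holds_record_dvd`
— `obtain ⟨ρ₀, B₁⋆, c₁⋆, hρ₀, -, -, hc₁⋆, hP6⟩ := prop6Printed_zdCubP_γ_holds_record_dvd θ hD hL5 (t := 1) le_rfl`, then pick `B₈` with `B₁⋆ ≤ 5dLB₈(1+11d²)` and the (8′)∕(9′)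
inequalities (`hB₀8 hγB hγB″ hB8β`), then apply the theorem; every OTHER displayed binder is a print socket ∕ letter text at PRINT-CLASS periodic members or `p5ePer ∕ p5uPer ∕ hP3`
(suppliers IR-N05-P5NS (ii) ∕ N06 ∕ dag-n05-w1's road) — none a derived-shape letter.
HONEST FRAMING: as part A — composition BY NAME; 0 estimates; every socket ∕ `hP3` ∕ `p5ePer` ∕ `p5uPer` ∕ `hP6` a HYPOTHESIS of print's shape, servable by name, NOT served here;
count-neutral; **N05 NOT discharged** (№227 (b)); FLAG №4 OPEN; Bałaban AS PRINTED; one finite 𝕋⁴ programme at fixed ε; nothing continuum ∕ ℝ⁴ ∕ OS ∕ mass-gap ∕ Clay.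
No `sorry`, no new definition.  Unit `pub-ymgap-dag-n05-d` (g14).
[cite: Balaban1985RegularSpaces, Lemma 1 – Thm 8 pp.79–101, Prop. 5 p.94, (1.3)–(1.5) p.77, p.77 («Ω_j ⊂ T_η»); Balaban1985BackgroundPropagators, Thm 3.3 p.399]
-/

noncomputable section

namespace Summit.QuantumFields.YangMills.BalabanUVNodes.N05SubBP2DK2PerKappaSlotExistsOfGuardedSocketsSlot8KappaPrime


open Literature.MathematicalPhysics.QuantumFieldTheory.Balaban1983to89
open Literature.MathematicalPhysics.QuantumFieldTheory.Balaban1983to89.Node00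
open Literature.MathematicalPhysics.QuantumFieldTheory.Balaban1983to89.B8IdxB8LawsB (IdxB8LawsB IdxB8SubB)
open Literature.MathematicalPhysics.QuantumFieldTheory.Balaban1983to89.B8LeafModelZd (ZdIdx)
open Literature.MathematicalPhysics.QuantumFieldTheory.Balaban1983to89.B8LeafModelZd3P2 (zdGF3HP₂)
open Literature.MathematicalPhysics.QuantumFieldTheory.Balaban1983to89.B8LeafModelZdHP2Per (zdGF3HP₂Per)
open Literature.MathematicalPhysics.QuantumFieldTheory.Balaban1983to89.B8TowerBondsPrinted (towerBondsP)
open Literature.MathematicalPhysics.QuantumFieldTheory.Balaban1983to89.B8Lemma1NonAbelian (mulCfg blockPairNA lemma1Printed_blockPairNA)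
open Literature.MathematicalPhysics.QuantumFieldTheory.Balaban1983to89.B8Thm8SurvivingZdGF3HP2PerMapLanEGammaGuarded (thm8SurvivingAt_zdGF3HP₂Per_map_lanE_γ'_guarded)
open Literature.MathematicalPhysics.QuantumFieldTheory.Balaban1983to89.B8Prop3SrcZdHP2PerGamma (sp3src_zdGF3HP₂Per_map_of_sockB9P3srcH2Per_γ)
open Literature.MathematicalPhysics.QuantumFieldTheory.Balaban1983to89.B8Thm4ZdGF3HP2PerMapGammaPrime (thm4Printed_zdGF3HP₂Per_mapJ_γ')
open Literature.MathematicalPhysics.QuantumFieldTheory.Balaban1983to89.B8Thm2ZdGF3HP2PerMapGammaPrime (thm2Printed_zdGF3HP₂Per_mapJ_γ')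
open Literature.MathematicalPhysics.QuantumFieldTheory.Balaban1983to89.B8LanF146 (LanF146 lanF146_top_iff lanF146_zero_iff)
open Literature.MathematicalPhysics.QuantumFieldTheory.Balaban1983to89.B8Eq138LandauZd (inR138_zero)
open Literature.MathematicalPhysics.QuantumFieldTheory.Balaban1983to89.B8Prop5LandauDataZdPer (zdLanPer)
open Summit.QuantumFields.YangMills.BalabanUVNodes.N05SubBP2DPerKappaSlotExistsGuarded (prop7PrintedR_famB8OfRecordSubBP₂DPer_unitAxial)
open T4TermwiseTorus (IsPeriodic)
open MatrixLog B7Prop1Explicit B7Prop2Explicit B7Prop1Local B7Eq92Concrete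
open B8Ineq130 (tlo thi)
open B8Ineq132 (InAk covDerivFwd)
open B8Eq119TwistedAxial (Restr129 InAx)
open B8Eq140Level (SideTouches)
open B8Eq138LandauZd (covLap InR138 IsLandau146W)
open B8Eq184Proof (gaugeExp cfgExp)
open B8Eq146AExpansion (iEta plaqCovDeriv)
open B8Eq143PlaqExpansion (pdiv)
open B7Prop4GeneralLevels (linCovIter)
open B8Eq155JBound (Jcur wsup)
open B8ScaledSupNorm (bondNorm msup Bdd msup_le bdd_of_forall)
open B9Eq340HolderZd (hquot AdmPair)

-- `Site` alone could resolve to the torus sites of `Setup.lean`; re-export the `ℤ^d` sites of `B7Prop1Explicit`.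
export B7Prop1Explicit (Site)

open Summit.QuantumFields.YangMills.BalabanUVNodes.N05SubBP2DK2PerKappaSlotExistsOfGuardedSockets (exists_residB8_slot8κ'_of_guardedSockets_at)

section Slot8κ'

variable (θ : Stage3Params)

/-- ★★★ **THE Slot8κ′ λ-TERM's ∃-BODY FROM THE GUARDED SOCKETS, LITERALLY** (dag-n24-c (R3′); plan (R4)): the theorem above at the period `P := Mκ·θ.L` with `1 ≤ Mκ`:
`∃ lam8, ∃ P c₁ ρ₀ ax, (0 < P ∧ Mκ * θ.L ∣ P) ∧ 0 < c₁ ∧ 1 ≤ ρ₀ ∧ B8LeafOfRecordSubBP₂DPerκ θ P Mκ Rκ ⟨lam8.cutSubBP₅κPer P Mκ Rκ c₁ ρ₀, ax⟩` — every displayed hypothesis a print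
socket text at the print-class periodic members of period `Mκ·θ.L` (the κ-index inhabitation guard `θ.L ≤ Rκ·Mκ` is the door's: `nonempty_idxB8SubDPerκ_slot8κ'` below).
[cite: Balaban1985RegularSpaces, Lemma 1 – Thm 8 pp.79–101, Prop. 5 p.94, (1.3)–(1.5) p.77, p.77 («Ω_j ⊂ T_η»); Balaban1985BackgroundPropagators, Thm 3.3 p.399] -/
theorem exists_residB8_slot8κ'_of_guardedSockets (hD : 2 ≤ θ.D) (Mκ Rκ : ℕ) (hM₁ : 1 ≤ Mκ)
    {B₀ B₀' B₀β β : ℝ} {len : Site θ.D → ℝ} (hB₀ : 0 < B₀) (hB₀' : 0 < B₀') (hB₀β : 0 < B₀β)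
    {ρ₀ : ℕ} {B₁s c₁s : ℝ} (hρ₀ : 1 ≤ ρ₀) (hc₁s : 0 < c₁s)
    (hP6 : ∀ {ι : Type} (f : ι → ZdIdx θ.D θ.L) (B₁'' c₁'' : ℝ), B₁s ≤ B₁'' → c₁'' ≤ c₁s →
      B8.Prop6Printed θ.D (θ.L : ℝ) B₁'' c₁'' (fun j => zdCubP θ.𝔸 θ.L ρ₀ (f j)))
    {cP cu cP3 γ₈ γ' γ'' γβ B₈ B₈β : ℝ} (hcP : 0 < cP) (hcu : 0 < cu) (hcP3 : 0 < cP3) (hγ₈ : 1 ≤ γ₈) (hγ' : 0 ≤ γ') (hγ'' : 0 ≤ γ'')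
    (hB : 2 ≤ 5 * (θ.D : ℝ) * θ.L * B₀) (hB₀8 : B₀ ≤ B₈)
    (hγB : 5 * (θ.D : ℝ) * θ.L * B₀ + 2 * (γ' * B₀) ≤ 5 * (θ.D : ℝ) * θ.L * B₈)
    (hγB'' : 5 * (θ.D : ℝ) * θ.L * B₀ + 2 * (γ'' * B₀) ≤ 5 * (θ.D : ℝ) * θ.L * B₈)
    (hB8β : 5 * (θ.D : ℝ) * θ.L * B₀β + 2 * B₀β * (γ'' * B₀) + γβ ≤ 5 * (θ.D : ℝ) * θ.L * B₈β)
    (hB₁big : B₁s ≤ 5 * (θ.D : ℝ) * θ.L * B₈ * (1 + 11 * (θ.D : ℝ) ^ 2))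
    (SP5base : ∀ a : IdxB8SubDPerκ θ (Mκ * θ.L) Mκ Rκ, ∀ α₀ α₁ : ℝ, 0 < α₀ → 0 < α₁ → α₀ + α₁ ≤ cP →
      ∀ U₀ U' : Site θ.D → Fin θ.D → θ.𝔸ˣ, (∀ x κ, U₀ x κ ∈ unitaryUnits θ.𝔸) → (∀ x κ, U' x κ ∈ unitaryUnits θ.𝔸) →
      IsPeriodic (Mκ * θ.L) U₀ → IsPeriodic (Mκ * θ.L) U' → ∀ φ : Site θ.D → θ.𝔸, (((InR138 θ.L a.toZdIdx.k a.toZdIdx.η (a.toZdIdx.Ω 0) (a.toZdIdx.Λs a.toZdIdx.k) U₀ φ ∧ (∀ x, IsSelfAdjoint (φ x)) ∧ (∀ x, x ∉ a.toZdIdx.Ω 0 → φ x = 0) ∧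
          Bdd θ.L a.toZdIdx.k a.toZdIdx.η (-(2 : ℝ)) (fun j (x : Site θ.D) => x ∈ a.toZdIdx.Ω j) φ) ∧ IsPeriodic (Mκ * θ.L) φ) ∧
        msup θ.L a.toZdIdx.k a.toZdIdx.η (-(2 : ℝ)) (fun j (x : Site θ.D) => x ∈ a.toZdIdx.Ω j) φ < γ₈ * (α₀ + α₁)) →
      InAk θ.L a.toZdIdx.k a.toZdIdx.η α₀ a.toZdIdx.Ω U₀ → InAk θ.L a.toZdIdx.k a.toZdIdx.η α₀ a.toZdIdx.Ω (mulCfg U' U₀) → (∀ m, m ≤ a.toZdIdx.k → InAx θ.L m (a.toZdIdx.Λs m) U₀ (mulCfg U' U₀)) →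
      (∀ j, j ≤ a.toZdIdx.k → ∀ (z : Site θ.D) (μ : Fin θ.D),
        ((∀ x, InBox (tlo θ.L z j) (thi θ.L z j) x → x ∈ a.toZdIdx.Ω j) ∨ (∀ x, InBox (tlo θ.L (z + e μ) j) (thi θ.L (z + e μ) j) x → x ∈ a.toZdIdx.Ω j)) →
        ‖(avgIter θ.L (mulCfg U' U₀) j z μ : θ.𝔸) - (avgIter θ.L U₀ j z μ : θ.𝔸)‖ ≤ α₁) →
      (∀ b ∈ {b : Site θ.D × Fin θ.D | SideTouches (a.toZdIdx.Ω 0) b.1 b.2}, ‖((U' b.1 b.2 : θ.𝔸ˣ) : θ.𝔸) - 1‖ ≤ α₁) →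
      (∃ (v : Site θ.D → θ.𝔸ˣ) (la : Site θ.D → θ.𝔸), (∀ x, v x ∈ unitaryUnits θ.𝔸) ∧ (∀ x, x ∉ a.toZdIdx.Ω 0 → v x = 1) ∧
        (∀ j, j ≤ 1 → ∀ b ∈ {b : Site θ.D × Fin θ.D | SideTouches (a.toZdIdx.Ω j) b.1 b.2}, (v b.1 : θ.𝔸) = ((gaugeExp la b.1 : θ.𝔸ˣ) : θ.𝔸) ∧
        (v (b.1 + e b.2) : θ.𝔸) = ((gaugeExp la (b.1 + e b.2) : θ.𝔸ˣ) : θ.𝔸)) ∧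
        (∀ j, j ≤ 1 → ∀ b ∈ {b : Site θ.D × Fin θ.D | SideTouches (a.toZdIdx.Ω j) b.1 b.2},
        ‖la b.1‖ ≤ (8 * B₀' * (5 * (θ.D : ℝ) * θ.L * B₈) * (α₀ + α₁)) ∧ ((θ.L : ℝ) ^ j * a.toZdIdx.η) * ‖covDerivFwd a.toZdIdx.η U₀ b.2 la b.1‖ ≤ (8 * B₀' * (5 * (θ.D : ℝ) * θ.L * B₈) * (α₀ + α₁))) ∧
        LanF146 θ.L a.toZdIdx.k a.toZdIdx.η (a.toZdIdx.Ω 0) a.toZdIdx.Λs U₀ φ 1 (mgauge U₀ v⁻¹ U') ∧ Restr129 θ.L 1 (a.toZdIdx.Λs 1) U₀ ((1 : Site θ.D → θ.𝔸ˣ) * v) ∧ IsPeriodic (Mκ * θ.L) v))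
    (SP5 : ∀ a : IdxB8SubDPerκ θ (Mκ * θ.L) Mκ Rκ, ∀ α₀ α₁ : ℝ, 0 < α₀ → 0 < α₁ → α₀ + α₁ ≤ cP →
      ∀ U₀ U' : Site θ.D → Fin θ.D → θ.𝔸ˣ, (∀ x κ, U₀ x κ ∈ unitaryUnits θ.𝔸) → (∀ x κ, U' x κ ∈ unitaryUnits θ.𝔸) →
      IsPeriodic (Mκ * θ.L) U₀ → IsPeriodic (Mκ * θ.L) U' → ∀ φ : Site θ.D → θ.𝔸, (((InR138 θ.L a.toZdIdx.k a.toZdIdx.η (a.toZdIdx.Ω 0) (a.toZdIdx.Λs a.toZdIdx.k) U₀ φ ∧ (∀ x, IsSelfAdjoint (φ x)) ∧ (∀ x, x ∉ a.toZdIdx.Ω 0 → φ x = 0) ∧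
          Bdd θ.L a.toZdIdx.k a.toZdIdx.η (-(2 : ℝ)) (fun j (x : Site θ.D) => x ∈ a.toZdIdx.Ω j) φ) ∧ IsPeriodic (Mκ * θ.L) φ) ∧
        msup θ.L a.toZdIdx.k a.toZdIdx.η (-(2 : ℝ)) (fun j (x : Site θ.D) => x ∈ a.toZdIdx.Ω j) φ < γ₈ * (α₀ + α₁)) →
      InAk θ.L a.toZdIdx.k a.toZdIdx.η α₀ a.toZdIdx.Ω U₀ → InAk θ.L a.toZdIdx.k a.toZdIdx.η α₀ a.toZdIdx.Ω (mulCfg U' U₀) → (∀ m, m ≤ a.toZdIdx.k → InAx θ.L m (a.toZdIdx.Λs m) U₀ (mulCfg U' U₀)) →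
      (∀ j, j ≤ a.toZdIdx.k → ∀ (z : Site θ.D) (μ : Fin θ.D),
        ((∀ x, InBox (tlo θ.L z j) (thi θ.L z j) x → x ∈ a.toZdIdx.Ω j) ∨ (∀ x, InBox (tlo θ.L (z + e μ) j) (thi θ.L (z + e μ) j) x → x ∈ a.toZdIdx.Ω j)) →
        ‖(avgIter θ.L (mulCfg U' U₀) j z μ : θ.𝔸) - (avgIter θ.L U₀ j z μ : θ.𝔸)‖ ≤ α₁) →
      (∀ b ∈ {b : Site θ.D × Fin θ.D | SideTouches (a.toZdIdx.Ω 0) b.1 b.2}, ‖((U' b.1 b.2 : θ.𝔸ˣ) : θ.𝔸) - 1‖ ≤ α₁) →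
      (∀ m, 1 ≤ m → m < a.toZdIdx.k → ∀ (u₁ : Site θ.D → θ.𝔸ˣ) (U₁ : Site θ.D → Fin θ.D → θ.𝔸ˣ) (A : Site θ.D → Fin θ.D → θ.𝔸),
        (∀ x, u₁ x ∈ unitaryUnits θ.𝔸) → (∀ x, x ∉ a.toZdIdx.Ω 0 → u₁ x = 1) → IsPeriodic (Mκ * θ.L) u₁ → IsPeriodic (Mκ * θ.L) U₁ → IsPeriodic (Mκ * θ.L) A →
        mgauge U₀ u₁ U₁ = U' → Restr129 θ.L m (a.toZdIdx.Λs m) U₀ u₁ →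
        LanF146 θ.L a.toZdIdx.k a.toZdIdx.η (a.toZdIdx.Ω 0) a.toZdIdx.Λs U₀ φ m U₁ →
        (∀ j, j ≤ m → ∀ b ∈ {b : Site θ.D × Fin θ.D | SideTouches (a.toZdIdx.Ω j) b.1 b.2},
        U₁ b.1 b.2 = cfgExp a.toZdIdx.η A b.1 b.2 ∧ IsSelfAdjoint (A b.1 b.2) ∧ ‖A b.1 b.2‖ ≤ (5 * (θ.D : ℝ) * θ.L * B₈ * (α₀ + α₁)) * ((θ.L : ℝ) ^ j * a.toZdIdx.η)⁻¹) →
        ∃ (v : Site θ.D → θ.𝔸ˣ) (la : Site θ.D → θ.𝔸), (∀ x, v x ∈ unitaryUnits θ.𝔸) ∧ (∀ x, x ∉ a.toZdIdx.Ω 0 → v x = 1) ∧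
        (∀ j, j ≤ m + 1 → ∀ b ∈ {b : Site θ.D × Fin θ.D | SideTouches (a.toZdIdx.Ω j) b.1 b.2}, (v b.1 : θ.𝔸) = ((gaugeExp la b.1 : θ.𝔸ˣ) : θ.𝔸) ∧
        (v (b.1 + e b.2) : θ.𝔸) = ((gaugeExp la (b.1 + e b.2) : θ.𝔸ˣ) : θ.𝔸)) ∧
        (∀ j, j ≤ m + 1 → ∀ b ∈ {b : Site θ.D × Fin θ.D | SideTouches (a.toZdIdx.Ω j) b.1 b.2},
        ‖la b.1‖ ≤ (8 * B₀' * (5 * (θ.D : ℝ) * θ.L * B₈) * (α₀ + α₁)) ∧ ((θ.L : ℝ) ^ j * a.toZdIdx.η) * ‖covDerivFwd a.toZdIdx.η U₀ b.2 la b.1‖ ≤ (8 * B₀' * (5 * (θ.D : ℝ) * θ.L * B₈) * (α₀ + α₁))) ∧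
        LanF146 θ.L a.toZdIdx.k a.toZdIdx.η (a.toZdIdx.Ω 0) a.toZdIdx.Λs U₀ φ (m + 1) (mgauge U₀ v⁻¹ U₁) ∧ Restr129 θ.L (m + 1) (a.toZdIdx.Λs (m + 1)) U₀ (u₁ * v) ∧ IsPeriodic (Mκ * θ.L) v))
    (SH59src : ∀ a : IdxB8SubDPerκ θ (Mκ * θ.L) Mκ Rκ, ∀ α₀ α₁ : ℝ, 0 < α₀ → 0 < α₁ → α₀ + α₁ ≤ cP →
      ∀ U₀ U' : Site θ.D → Fin θ.D → θ.𝔸ˣ, (∀ x κ, U₀ x κ ∈ unitaryUnits θ.𝔸) → (∀ x κ, U' x κ ∈ unitaryUnits θ.𝔸) →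
      IsPeriodic (Mκ * θ.L) U₀ → IsPeriodic (Mκ * θ.L) U' → ∀ φ : Site θ.D → θ.𝔸, (((InR138 θ.L a.toZdIdx.k a.toZdIdx.η (a.toZdIdx.Ω 0) (a.toZdIdx.Λs a.toZdIdx.k) U₀ φ ∧ (∀ x, IsSelfAdjoint (φ x)) ∧ (∀ x, x ∉ a.toZdIdx.Ω 0 → φ x = 0) ∧
          Bdd θ.L a.toZdIdx.k a.toZdIdx.η (-(2 : ℝ)) (fun j (x : Site θ.D) => x ∈ a.toZdIdx.Ω j) φ) ∧ IsPeriodic (Mκ * θ.L) φ) ∧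
        msup θ.L a.toZdIdx.k a.toZdIdx.η (-(2 : ℝ)) (fun j (x : Site θ.D) => x ∈ a.toZdIdx.Ω j) φ < γ₈ * (α₀ + α₁)) →
      InAk θ.L a.toZdIdx.k a.toZdIdx.η α₀ a.toZdIdx.Ω U₀ → InAk θ.L a.toZdIdx.k a.toZdIdx.η α₀ a.toZdIdx.Ω (mulCfg U' U₀) → (∀ m, m ≤ a.toZdIdx.k → InAx θ.L m (a.toZdIdx.Λs m) U₀ (mulCfg U' U₀)) →
      (∀ j, j ≤ a.toZdIdx.k → ∀ (z : Site θ.D) (μ : Fin θ.D),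
        ((∀ x, InBox (tlo θ.L z j) (thi θ.L z j) x → x ∈ a.toZdIdx.Ω j) ∨ (∀ x, InBox (tlo θ.L (z + e μ) j) (thi θ.L (z + e μ) j) x → x ∈ a.toZdIdx.Ω j)) →
        ‖(avgIter θ.L (mulCfg U' U₀) j z μ : θ.𝔸) - (avgIter θ.L U₀ j z μ : θ.𝔸)‖ ≤ α₁) →
      (∀ b ∈ {b : Site θ.D × Fin θ.D | SideTouches (a.toZdIdx.Ω 0) b.1 b.2}, ‖((U' b.1 b.2 : θ.𝔸ˣ) : θ.𝔸) - 1‖ ≤ α₁) →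
      (∀ m, 1 ≤ m → m ≤ a.toZdIdx.k → ∀ (u : Site θ.D → θ.𝔸ˣ) (W : Site θ.D → Fin θ.D → θ.𝔸ˣ) (A' : Site θ.D → Fin θ.D → θ.𝔸),
        (∀ x, u x ∈ unitaryUnits θ.𝔸) → IsPeriodic (Mκ * θ.L) u → IsPeriodic (Mκ * θ.L) W → IsPeriodic (Mκ * θ.L) A' →
        mgauge U₀ u W = U' → Restr129 θ.L m (a.toZdIdx.Λs m) U₀ u → LanF146 θ.L a.toZdIdx.k a.toZdIdx.η (a.toZdIdx.Ω 0) a.toZdIdx.Λs U₀ φ m W →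
        (∀ y τ, IsSelfAdjoint (A' y τ)) →
        (∀ j, j ≤ m → ∀ y τ, SideTouches (a.toZdIdx.Ω j) y τ →
        W y τ = cfgExp a.toZdIdx.η A' y τ ∧ ‖A' y τ‖ ≤ (2 * (θ.L * (5 * (θ.D : ℝ) * θ.L * B₈ * (α₀ + α₁))) + 8 * (8 * B₀' * (5 * (θ.D : ℝ) * θ.L * B₈) * (α₀ + α₁))) * ((θ.L : ℝ) ^ j * a.toZdIdx.η)⁻¹) →
        (∀ y τ, (∀ j, j ≤ m → ¬ SideTouches (a.toZdIdx.Ω j) y τ) → A' y τ = 0) →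
        msup θ.L m a.toZdIdx.η (-(1 : ℝ)) (fun j (b : Site θ.D × Fin θ.D) => SideTouches (a.toZdIdx.Ω j) b.1 b.2) (fun b => A' b.1 b.2)
        ≤ B₀ * (bondNorm θ.L m a.toZdIdx.η (-(3 : ℝ)) a.toZdIdx.Ω (fun x μ => Jcur a.toZdIdx.η U₀ A' μ x)
        + wsup 1 (fun p : {p : ℕ × (Site θ.D × Fin θ.D) // p.1 ≤ m ∧ p.2 ∈ towerBondsP θ.L a.toZdIdx.Ω (a.toZdIdx.Λs m) p.1} =>
        linCovIter θ.L U₀ (iEta a.toZdIdx.η A') p.1.1 p.1.2.1 p.1.2.2)) + γ' * B₀ * (α₀ + α₁) ∧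
        msup θ.L m a.toZdIdx.η (-(2 : ℝ)) (fun j (t : Fin θ.D × Fin θ.D × Site θ.D) => SideTouches (a.toZdIdx.Ω j) t.2.2 t.2.1)
        (fun t => covDerivFwd a.toZdIdx.η U₀ t.1 (fun z => A' z t.2.1) t.2.2)
        ≤ B₀ * (bondNorm θ.L m a.toZdIdx.η (-(3 : ℝ)) a.toZdIdx.Ω (fun x μ => Jcur a.toZdIdx.η U₀ A' μ x)
        + wsup 1 (fun p : {p : ℕ × (Site θ.D × Fin θ.D) // p.1 ≤ m ∧ p.2 ∈ towerBondsP θ.L a.toZdIdx.Ω (a.toZdIdx.Λs m) p.1} =>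
        linCovIter θ.L U₀ (iEta a.toZdIdx.η A') p.1.1 p.1.2.1 p.1.2.2)) + γ' * B₀ * (α₀ + α₁)))
    (SP5u : ∀ a : IdxB8SubDPerκ θ (Mκ * θ.L) Mκ Rκ, ∀ α₀ α₁ : ℝ, 0 < α₀ → 0 < α₁ → α₀ + α₁ ≤ cP →
      ∀ U₀ U' : Site θ.D → Fin θ.D → θ.𝔸ˣ, (∀ x κ, U₀ x κ ∈ unitaryUnits θ.𝔸) → (∀ x κ, U' x κ ∈ unitaryUnits θ.𝔸) →
      IsPeriodic (Mκ * θ.L) U₀ → IsPeriodic (Mκ * θ.L) U' → ∀ φ : Site θ.D → θ.𝔸, (((InR138 θ.L a.toZdIdx.k a.toZdIdx.η (a.toZdIdx.Ω 0) (a.toZdIdx.Λs a.toZdIdx.k) U₀ φ ∧ (∀ x, IsSelfAdjoint (φ x)) ∧ (∀ x, x ∉ a.toZdIdx.Ω 0 → φ x = 0) ∧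
          Bdd θ.L a.toZdIdx.k a.toZdIdx.η (-(2 : ℝ)) (fun j (x : Site θ.D) => x ∈ a.toZdIdx.Ω j) φ) ∧ IsPeriodic (Mκ * θ.L) φ) ∧
        msup θ.L a.toZdIdx.k a.toZdIdx.η (-(2 : ℝ)) (fun j (x : Site θ.D) => x ∈ a.toZdIdx.Ω j) φ < γ₈ * (α₀ + α₁)) →
      InAk θ.L a.toZdIdx.k a.toZdIdx.η α₀ a.toZdIdx.Ω U₀ → InAk θ.L a.toZdIdx.k a.toZdIdx.η α₀ a.toZdIdx.Ω (mulCfg U' U₀) → (∀ m, m ≤ a.toZdIdx.k → InAx θ.L m (a.toZdIdx.Λs m) U₀ (mulCfg U' U₀)) →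
      (∀ j, j ≤ a.toZdIdx.k → ∀ (z : Site θ.D) (μ : Fin θ.D),
        ((∀ x, InBox (tlo θ.L z j) (thi θ.L z j) x → x ∈ a.toZdIdx.Ω j) ∨ (∀ x, InBox (tlo θ.L (z + e μ) j) (thi θ.L (z + e μ) j) x → x ∈ a.toZdIdx.Ω j)) →
        ‖(avgIter θ.L (mulCfg U' U₀) j z μ : θ.𝔸) - (avgIter θ.L U₀ j z μ : θ.𝔸)‖ ≤ α₁) →
      (∀ b ∈ {b : Site θ.D × Fin θ.D | SideTouches (a.toZdIdx.Ω 0) b.1 b.2}, ‖((U' b.1 b.2 : θ.𝔸ˣ) : θ.𝔸) - 1‖ ≤ α₁) →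
      ∀ u₁ : Site θ.D → θ.𝔸ˣ, (∀ x, u₁ x ∈ unitaryUnits θ.𝔸) → (∀ x, x ∉ a.toZdIdx.Ω 0 → u₁ x = 1) → IsPeriodic (Mκ * θ.L) u₁ → Restr129 θ.L a.toZdIdx.k (a.toZdIdx.Λs a.toZdIdx.k) U₀ u₁ →
      LanF146 θ.L a.toZdIdx.k a.toZdIdx.η (a.toZdIdx.Ω 0) a.toZdIdx.Λs U₀ φ a.toZdIdx.k (mgauge U₀ u₁⁻¹ U') →
      (∃ A₁ : Site θ.D → Fin θ.D → θ.𝔸, ∀ j, j ≤ a.toZdIdx.k → ∀ (x : Site θ.D) (κ : Fin θ.D), SideTouches (a.toZdIdx.Ω j) x κ →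
        mgauge U₀ u₁⁻¹ U' x κ = cfgExp a.toZdIdx.η A₁ x κ ∧ ‖A₁ x κ‖ ≤ (5 * (θ.D : ℝ) * θ.L * B₈ * (α₀ + α₁)) * ((θ.L : ℝ) ^ j * a.toZdIdx.η)⁻¹) →
      ∀ (v w : Site θ.D → θ.𝔸ˣ) (la mu : Site θ.D → θ.𝔸),
      IsPeriodic (Mκ * θ.L) v → IsPeriodic (Mκ * θ.L) w → IsPeriodic (Mκ * θ.L) la → IsPeriodic (Mκ * θ.L) mu →
      (∀ x, ((gaugeExp la x : θ.𝔸ˣ) : θ.𝔸) = ((v x : θ.𝔸ˣ) : θ.𝔸) ∧ IsSelfAdjoint (la x) ∧ ‖la x‖ < cu) → (∀ x, x ∉ a.toZdIdx.Ω 0 → la x = 0) →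
      (∀ j, j ≤ a.toZdIdx.k → ∀ b ∈ {b : Site θ.D × Fin θ.D | SideTouches (a.toZdIdx.Ω j) b.1 b.2}, ((θ.L : ℝ) ^ j * a.toZdIdx.η) * ‖covDerivFwd a.toZdIdx.η U₀ b.2 la b.1‖ < cu) →
      (∀ x, ((gaugeExp mu x : θ.𝔸ˣ) : θ.𝔸) = ((w x : θ.𝔸ˣ) : θ.𝔸) ∧ IsSelfAdjoint (mu x) ∧ ‖mu x‖ < cu) → (∀ x, x ∉ a.toZdIdx.Ω 0 → mu x = 0) →
      (∀ j, j ≤ a.toZdIdx.k → ∀ b ∈ {b : Site θ.D × Fin θ.D | SideTouches (a.toZdIdx.Ω j) b.1 b.2}, ((θ.L : ℝ) ^ j * a.toZdIdx.η) * ‖covDerivFwd a.toZdIdx.η U₀ b.2 mu b.1‖ < cu) →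
      LanF146 θ.L a.toZdIdx.k a.toZdIdx.η (a.toZdIdx.Ω 0) a.toZdIdx.Λs U₀ φ a.toZdIdx.k (mgauge U₀ v⁻¹ (mgauge U₀ u₁⁻¹ U')) → Restr129 θ.L a.toZdIdx.k (a.toZdIdx.Λs a.toZdIdx.k) U₀ (u₁ * v) →
      LanF146 θ.L a.toZdIdx.k a.toZdIdx.η (a.toZdIdx.Ω 0) a.toZdIdx.Λs U₀ φ a.toZdIdx.k (mgauge U₀ w⁻¹ (mgauge U₀ u₁⁻¹ U')) → Restr129 θ.L a.toZdIdx.k (a.toZdIdx.Λs a.toZdIdx.k) U₀ (u₁ * w) →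
      ∀ x, v x = w x)
    -- THE GUARDED SOURCED b9 SOCKET OF PROPOSITION 3's FRAME at the PERIODIC (1.5)-index, threshold `cP3` — HYPOTHESIS
    -- ([Balaban1985BackgroundPropagators] Thm 3.3 with source, asked at periodic `U₀, W, f, A′` only; = T6e's input letter for letter)
    (SB9srcH2Per : ∀ a : IdxB8SubDPerκ θ (Mκ * θ.L) Mκ Rκ, ∀ α₀ α₁ α₂ : ℝ, 0 < α₀ → α₀ ≤ cP3 → 0 < α₁ → 0 < α₂ → α₂ ≤ cP3 →
      ∀ (U₀ W : Site θ.D → Fin θ.D → θ.𝔸ˣ), (∀ x κ, U₀ x κ ∈ unitaryUnits θ.𝔸) → (∀ x κ, W x κ ∈ unitaryUnits θ.𝔸) →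
      IsPeriodic (Mκ * θ.L) U₀ → IsPeriodic (Mκ * θ.L) W →
      ∀ f : Site θ.D → θ.𝔸, IsPeriodic (Mκ * θ.L) f → InR138 θ.L a.toZdIdx.k a.toZdIdx.η (a.toZdIdx.Ω 0) (a.toZdIdx.Λs a.toZdIdx.k) U₀ f →
      (∀ x, IsSelfAdjoint (f x)) → (∀ x, x ∉ a.toZdIdx.Ω 0 → f x = 0) →
      Bdd θ.L a.toZdIdx.k a.toZdIdx.η (-(2 : ℝ)) (fun j (x : Site θ.D) => x ∈ a.toZdIdx.Ω j) f →
      msup θ.L a.toZdIdx.k a.toZdIdx.η (-(2 : ℝ)) (fun j (x : Site θ.D) => x ∈ a.toZdIdx.Ω j) f < γ₈ * (α₀ + α₁) →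
      msup θ.L a.toZdIdx.k a.toZdIdx.η (-(3 : ℝ)) (fun j (p : Fin θ.D × Site θ.D) => p.2 ∈ a.toZdIdx.Ω j) (fun p => covDerivFwd a.toZdIdx.η U₀ p.1 f p.2) < γ₈ * (α₀ + α₁) →
      InAk θ.L a.toZdIdx.k a.toZdIdx.η α₀ a.toZdIdx.Ω U₀ → InAk θ.L a.toZdIdx.k a.toZdIdx.η α₀ a.toZdIdx.Ω (mulCfg W U₀) → IsLandau146W θ.L a.toZdIdx.k a.toZdIdx.η (a.toZdIdx.Ω 0) (a.toZdIdx.Λs a.toZdIdx.k) U₀ f W →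
      ∀ A' : Site θ.D → Fin θ.D → θ.𝔸, (∀ y τ, IsSelfAdjoint (A' y τ)) → IsPeriodic (Mκ * θ.L) A' →
      (∀ j, j ≤ a.toZdIdx.k → ∀ (y : Site θ.D) (τ : Fin θ.D), SideTouches (a.toZdIdx.Ω j) y τ →
        W y τ = cfgExp a.toZdIdx.η A' y τ ∧ ‖A' y τ‖ ≤ α₂ * ((θ.L : ℝ) ^ j * a.toZdIdx.η)⁻¹) →
      (∀ (y : Site θ.D) (τ : Fin θ.D), (∀ j, j ≤ a.toZdIdx.k → ¬ SideTouches (a.toZdIdx.Ω j) y τ) → A' y τ = 0) →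
      msup θ.L a.toZdIdx.k a.toZdIdx.η (-(1 : ℝ)) (fun j (b : Site θ.D × Fin θ.D) => SideTouches (a.toZdIdx.Ω j) b.1 b.2) (fun b => A' b.1 b.2)
          ≤ B₀ * (bondNorm θ.L a.toZdIdx.k a.toZdIdx.η (-(3 : ℝ)) a.toZdIdx.Ω (fun x μ => Jcur a.toZdIdx.η U₀ A' μ x)
            + wsup 1 (fun p : {p : ℕ × (Site θ.D × Fin θ.D) // p.1 ≤ a.toZdIdx.k ∧ p.2 ∈ towerBondsP θ.L a.toZdIdx.Ω (a.toZdIdx.Λs a.toZdIdx.k) p.1} =>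
                linCovIter θ.L U₀ (iEta a.toZdIdx.η A') p.1.1 p.1.2.1 p.1.2.2)) + γ'' * B₀ * (α₀ + α₁) ∧
        msup θ.L a.toZdIdx.k a.toZdIdx.η (-(2 : ℝ)) (fun j (t : Fin θ.D × Fin θ.D × Site θ.D) => SideTouches (a.toZdIdx.Ω j) t.2.2 t.2.1)
            (fun t => covDerivFwd a.toZdIdx.η U₀ t.1 (fun z => A' z t.2.1) t.2.2)
          ≤ B₀ * (bondNorm θ.L a.toZdIdx.k a.toZdIdx.η (-(3 : ℝ)) a.toZdIdx.Ω (fun x μ => Jcur a.toZdIdx.η U₀ A' μ x)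
            + wsup 1 (fun p : {p : ℕ × (Site θ.D × Fin θ.D) // p.1 ≤ a.toZdIdx.k ∧ p.2 ∈ towerBondsP θ.L a.toZdIdx.Ω (a.toZdIdx.Λs a.toZdIdx.k) p.1} =>
                linCovIter θ.L U₀ (iEta a.toZdIdx.η A') p.1.1 p.1.2.1 p.1.2.2)) + γ'' * B₀ * (α₀ + α₁) ∧
        bondNorm θ.L a.toZdIdx.k a.toZdIdx.η (-(3 : ℝ)) a.toZdIdx.Ω (fun x μ => pdiv a.toZdIdx.η U₀ (plaqCovDeriv a.toZdIdx.η U₀ A') μ x)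
          ≤ B₀ * (bondNorm θ.L a.toZdIdx.k a.toZdIdx.η (-(3 : ℝ)) a.toZdIdx.Ω (fun x μ => Jcur a.toZdIdx.η U₀ A' μ x)
            + wsup 1 (fun p : {p : ℕ × (Site θ.D × Fin θ.D) // p.1 ≤ a.toZdIdx.k ∧ p.2 ∈ towerBondsP θ.L a.toZdIdx.Ω (a.toZdIdx.Λs a.toZdIdx.k) p.1} =>
                linCovIter θ.L U₀ (iEta a.toZdIdx.η A') p.1.1 p.1.2.1 p.1.2.2)) + γ'' * B₀ * (α₀ + α₁) ∧
        bondNorm θ.L a.toZdIdx.k a.toZdIdx.η (-(3 : ℝ)) a.toZdIdx.Ω (fun x μ => covLap a.toZdIdx.η U₀ (fun z => A' z μ) x)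
          ≤ B₀ * (bondNorm θ.L a.toZdIdx.k a.toZdIdx.η (-(3 : ℝ)) a.toZdIdx.Ω (fun x μ => Jcur a.toZdIdx.η U₀ A' μ x)
            + wsup 1 (fun p : {p : ℕ × (Site θ.D × Fin θ.D) // p.1 ≤ a.toZdIdx.k ∧ p.2 ∈ towerBondsP θ.L a.toZdIdx.Ω (a.toZdIdx.Λs a.toZdIdx.k) p.1} =>
                linCovIter θ.L U₀ (iEta a.toZdIdx.η A') p.1.1 p.1.2.1 p.1.2.2)) + γ'' * B₀ * (α₀ + α₁) ∧
        msup θ.L a.toZdIdx.k a.toZdIdx.η (-(2 + β)) (fun j (q : Fin θ.D × Fin θ.D × (Site θ.D × Site θ.D)) => q.2.2 ∈ AdmPair a.toZdIdx.η len ∧ q.2.2.1 ∈ a.toZdIdx.Ω j ∧ q.2.2.2 ∈ a.toZdIdx.Ω j)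
            (fun q => hquot a.toZdIdx.η β len U₀ (covDerivFwd a.toZdIdx.η U₀ q.1 (fun z => A' z q.2.1)) q.2.2)
          ≤ B₀β * (bondNorm θ.L a.toZdIdx.k a.toZdIdx.η (-(3 : ℝ)) a.toZdIdx.Ω (fun x μ => Jcur a.toZdIdx.η U₀ A' μ x)
            + wsup 1 (fun p : {p : ℕ × (Site θ.D × Fin θ.D) // p.1 ≤ a.toZdIdx.k ∧ p.2 ∈ towerBondsP θ.L a.toZdIdx.Ω (a.toZdIdx.Λs a.toZdIdx.k) p.1} =>
                linCovIter θ.L U₀ (iEta a.toZdIdx.η A') p.1.1 p.1.2.1 p.1.2.2)) + γβ * (α₀ + α₁))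
    (hP3 : B8.Prop3Printed θ.D (θ.L : ℝ) (2097152 * ((θ.D : ℝ) + 1) ^ 2 * (θ.L : ℝ) ^ 2) ⟨B₀, B₀', hB₀, hB₀'⟩ B₀β
      (fun j : IdxB8SubDPerκ θ (Mκ * θ.L) Mκ Rκ => (famB8OfRecordSubBP₂DPer θ β len (Mκ * θ.L) j.1).toGFData2))
    (p5ePer : B8.Prop5Exists B₀' (5 * (θ.D : ℝ) * θ.L * B₈ * (1 + 11 * (θ.D : ℝ) ^ 2))
      (lanOfRecordSubCκPer θ (Mκ * θ.L) Mκ Rκ (5 * (θ.D : ℝ) * θ.L * B₈ * (1 + 11 * (θ.D : ℝ) ^ 2))))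
    (p5uPer : B8.Prop5Unique (lanOfRecordSubCκPer θ (Mκ * θ.L) Mκ Rκ (5 * (θ.D : ℝ) * θ.L * B₈ * (1 + 11 * (θ.D : ℝ) ^ 2)))) :
    ∃ (lam8 : ResidB8 θ) (P : ℕ) (c₁ : ℝ) (ρ₀' : ℕ)
      (ax : ∀ j : IdxB8SubDPer θ P, (famB8OfRecordPer θ (lam8.cutSubBP₅κPer P Mκ Rκ c₁ ρ₀').β (lam8.cutSubBP₅κPer P Mκ Rκ c₁ ρ₀').len P j).Cfg →
        (famB8OfRecordPer θ (lam8.cutSubBP₅κPer P Mκ Rκ c₁ ρ₀').β (lam8.cutSubBP₅κPer P Mκ Rκ c₁ ρ₀').len P j).Pert →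
        (famB8OfRecordPer θ (lam8.cutSubBP₅κPer P Mκ Rκ c₁ ρ₀').β (lam8.cutSubBP₅κPer P Mκ Rκ c₁ ρ₀').len P j).Pert),
      (0 < P ∧ Mκ * θ.L ∣ P) ∧ 0 < c₁ ∧ 1 ≤ ρ₀' ∧ B8LeafOfRecordSubBP₂DPerκ θ P Mκ Rκ ⟨lam8.cutSubBP₅κPer P Mκ Rκ c₁ ρ₀', ax⟩ := by
  obtain ⟨lam, c₁, ρ₀', ax, hc₁, hρ₀', h⟩ := exists_residB8_slot8κ'_of_guardedSockets_at θ hD Mκ Rκ (Mκ * θ.L) hB₀ hB₀' hB₀β hρ₀ hc₁s hP6 hcP hcu hcP3 hγ₈ hγ' hγ''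
    hB hB₀8 hγB hγB'' hB8β hB₁big SP5base SP5 SH59src SP5u SB9srcH2Per hP3 p5ePer p5uPer
  have hL1 : 1 ≤ θ.L := le_trans one_le_two θ.two_le_L
  exact ⟨lam, Mκ * θ.L, c₁, ρ₀', ax, ⟨Nat.mul_pos (Nat.lt_of_lt_of_le Nat.zero_lt_one hM₁) (Nat.lt_of_lt_of_le Nat.zero_lt_one hL1), dvd_rfl⟩, hc₁, hρ₀', h⟩

end Slot8κ'

end Summit.QuantumFields.YangMills.BalabanUVNodes.N05SubBP2DK2PerKappaSlotExistsOfGuardedSocketsSlot8KappaPrime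

end
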